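import Literature.AlgebraicGeometry.Frobenioids.ArchimedeanUnitCircleAngular
import Literature.AlgebraicGeometry.Frobenioids.ArchimedeanTheoremsInstances
import HarnessLib

/-!
# Frobenioids II, Theorem 3.6 (vii), last sentence — PROVED for `C = C^ℤ` and `A`: `∂A_A` is an `O^×(A)`-torsor

Mochizuki, *The geometry of Frobenioids II*, Kyushu J. Math. **62** (2008) 401–460, §3, Theorem 3.6
(vii), author's kurims text p. 38 [cite: MochizukiFrdII2008, Thm 3.6 (vii) p.38]: "… if `A` is isotropic,
then the action of `O^×(A)` on `∂A_A` determines on `∂A_A` a structure of torsor over this group."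

DISCHARGE of the clause `ArchFrd.Thm36vii_torsor` at the archimedean Frobenioid `C π` of Example 3.3 (the
instance recorded in `ArchimedeanTheoremsInstances.lean`: ambient space `ℂ^×`, boundary
`∂A_A = {u ∈ A_A : |u| = tip}`, underlying maps `z ↦ ι⁻¹(c · z^{deg})`): for a complex isotropic `A`, every
element of `O^×(A)` is `((id, 1, c), id)` with `|c| = 1` (`ArchimedeanUnitCircle.lean`) and acts on `∂A_A`
by `z ↦ c · z`; given `x, y ∈ ∂A_A` the unique such `c` is `y · x⁻¹`. The same for the angular
Frobenioid `A ⊆ C` (`thm36vii_torsor_A`, via `ArchimedeanUnitCircleAngular.lean`).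
No statement of the paper is strengthened.
-/

namespace Literature.AlgebraicGeometry.Frobenioids

open CategoryTheory

universe v u

namespace ArchFrd

variable {D : Type u} [Category.{v} D] (π : D ⥤ D0)

/-- The underlying map of an element `u ∈ O^×(A)` (naively isotropic `A`) is multiplication by its scalar.
[cite: MochizukiFrdII2008, Thm 3.6 (vii) p.38] -/
theorem vMap_of_mem_unitsSubgroup (A : C π) (u : Aut A)
    (hu : u ∈ PreFrobenioid.unitsSubgroup (C.toElem π) A) (z : ℂˣ) :
    vMap π u.hom z = C0.scalar u.hom.fst * z := by
  obtain ⟨hb, hd⟩ := hu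
  have hsnd : u.hom.snd = 𝟙 A.snd := hb
  have hdeg : C0.degFr u.hom.fst = 1 := hd
  have hbase : C0.Base u.hom.fst = 𝟙 A.fst.base := by
    have hw := u.hom.w
    rw [hsnd, CategoryTheory.Functor.map_id, Category.comp_id] at hw
    exact (cancel_mono A.iso.hom).mp (hw.trans (Category.id_comp _).symm)
  unfold vMap
  rw [hbase, hdeg, D0.twists_id, D0.galAct_false, PNat.one_coe, pow_one]

/-- A boundary point has absolute value `tip(A)` (as a real number). [cite: MochizukiFrdII2008, Def 3.1 (iii) p.24] -/
theorem norm_eq_tip_of_mem_boundary {A : AngularRegion ℂ} {x : ℂˣ} (hx : x ∈ A.boundary) :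
    ‖(x : ℂ)‖ = A.tip := by
  rw [← coe_absHom, hx.2]

/-- **Theorem 3.6 (vii), last sentence, for `C = C^ℤ`** (PROVED): for complex isotropic `A`, `∂A_A` is a
torsor under `O^×(A)`. [cite: MochizukiFrdII2008, Thm 3.6 (vii) p.38] -/
theorem thm36vii_torsor_C :
    Thm36vii_torsor (baseRC π) (C.toElem π) MonoidType.Z (ambient π) (bd π) (vMap π) := by
  intro _ A hAc hAi x hx y hy
  have hA : A.fst.IsNaivelyIsotropic := isNaivelyIsotropic_fst_of_isIsotropic π A hAi
  have hπ : (π.obj A.snd).IsComplex := (D0.isComplex_toArchBase_iff _).mp hAc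
  have hc : A.fst.IsComplexObj := D0.isComplex_of_hom A.iso.hom hπ
  have hxn : ‖(x : ℂ)‖ = A.fst.region.tip := norm_eq_tip_of_mem_boundary hx
  have hyn : ‖(y : ℂ)‖ = A.fst.region.tip := norm_eq_tip_of_mem_boundary hy
  -- the scalar `c = y · x⁻¹`
  have hn : ‖((y * x⁻¹ : ℂˣ) : ℂ)‖ = 1 := by
    rw [Units.val_mul, Units.val_inv_eq_inv_val, norm_mul, norm_inv, hxn, hyn,
      mul_inv_cancel₀ A.fst.region.tip.2.ne']
  refine ⟨⟨unitAutOver π A hA hc (y * x⁻¹) hn, unitAutOver_mem π A hA hc _ _⟩, ?_, ?_⟩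
  · change vMap π (unitAutOver π A hA hc (y * x⁻¹) hn).hom x = y
    rw [vMap_of_mem_unitsSubgroup π A _ (unitAutOver_mem π A hA hc _ _)]
    change y * x⁻¹ * x = y
    rw [inv_mul_cancel_right]
  · rintro ⟨u, hu⟩ h
    change vMap π u.hom x = y at h
    rw [vMap_of_mem_unitsSubgroup π A u hu] at h
    have hsc : C0.scalar u.hom.fst = y * x⁻¹ := by rw [← h, mul_inv_cancel_right]
    apply Subtype.ext
    change u = unitAutOver π A hA hc (y * x⁻¹) hn
    refine (eq_unitAutOver_of_mem π A hA hc u hu).trans ?_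
    congr 1

/-- **Theorem 3.6 (vii), last sentence, for the angular Frobenioid `A`** (PROVED; transported along
`A ⊆ C`: the elements of `O^×` of `A` are the unit-scalar automorphisms, which are isometries).
[cite: MochizukiFrdII2008, Thm 3.6 (vii) p.38] -/
theorem thm36vii_torsor_A :
    Thm36vii_torsor (baseRC π) (A.toElem π) MonoidType.Z (fun X => ambient π X.obj) (bdA π) (vMapA π) := by
  intro _ X hXc hXi x hx y hy
  have hX : X.obj.fst.IsNaivelyIsotropic := A.isNaivelyIsotropic_of_isIsotropic π X hXi
  have hπ : (π.obj X.obj.snd).IsComplex := (D0.isComplex_toArchBase_iff _).mp hXc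
  have hc : X.obj.fst.IsComplexObj := D0.isComplex_of_hom X.obj.iso.hom hπ
  have hxn : ‖(x : ℂ)‖ = X.obj.fst.region.tip := norm_eq_tip_of_mem_boundary hx
  have hyn : ‖(y : ℂ)‖ = X.obj.fst.region.tip := norm_eq_tip_of_mem_boundary hy
  have hn : ‖((y * x⁻¹ : ℂˣ) : ℂ)‖ = 1 := by
    rw [Units.val_mul, Units.val_inv_eq_inv_val, norm_mul, norm_inv, hxn, hyn,
      mul_inv_cancel₀ X.obj.fst.region.tip.2.ne']
  refine ⟨⟨A.unitAutOver π X hX hc (y * x⁻¹) hn, A.unitAutOver_mem π X hX hc _ _⟩, ?_, ?_⟩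
  · change vMap π (unitAutOver π X.obj hX hc (y * x⁻¹) hn).hom x = y
    rw [vMap_of_mem_unitsSubgroup π X.obj _ (unitAutOver_mem π X.obj hX hc _ _)]
    change y * x⁻¹ * x = y
    rw [inv_mul_cancel_right]
  · rintro ⟨u, hu⟩ h
    have huC := A.mapIso_mem_unitsSubgroup π X u hu
    change vMap π ((A.ι π).mapIso u).hom x = y at h
    have h3 : C0.scalar ((A.ι π).mapIso u).hom.fst * x = y :=
      (vMap_of_mem_unitsSubgroup π X.obj _ huC x).symm.trans h
    have hsc : C0.scalar ((A.ι π).mapIso u).hom.fst = y * x⁻¹ := by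
      rw [← h3, mul_inv_cancel_right]
    apply Subtype.ext
    change u = A.unitAutOver π X hX hc (y * x⁻¹) hn
    apply Iso.ext
    apply WideSubcategory.hom_ext
    have e := congrArg Iso.hom (eq_unitAutOver_of_mem π X.obj hX hc ((A.ι π).mapIso u) huC)
    refine e.trans ?_
    change (ArchFrd.unitAutOver π X.obj hX hc _ _).hom = (ArchFrd.unitAutOver π X.obj hX hc _ _).hom
    congr 2

end ArchFrd

end Literature.AlgebraicGeometry.Frobenioids
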